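import Literature.IUT.LogThetaLattice.LatticeGlueOfKitsToy
import HarnessLib

/-!
# [IUTchIII] Thm 1.5 (v) / [IUTchII] Cor 4.10 (v) at a CONCRETE glued kit-frame datum `G : LatticeGlue S`: the GAP-row signature
# `G.biCoric.realified.mapIso a = Iso.refl _` instantiated with NO hypothesis (proof-only)

Proof-only corollary file (abc-iut cell, NV-L6 wave / plan/GAP-LEDGER.md row G-w4d009-1; seat abc-iut-w4-d005; 0 defs) of
abc-iut-L6-t3's `LatticeGlueOfKitsToy.lean` (p420737: `KitsToy.latticeGlue : LatticeGlue (KitsToy.frame l hl)`, the FIRST glued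
[IUTchIII] §1–§2 datum over an assembled kit frame, whose bi-coric kit is this seat's `KitsToy.biCoricKit` of `BiCoresOfKitsToy.lean`,
p420509, with the [IUTchII] Cor 4.5 (ii) slot shaped as `RlfImage` / `realifiedDSmall`). S. Mochizuki, *Inter-universal Teichmüller
theory III*, kurims (May 2020), Thm 1.5 (v) pp. 50–51; *II* (Dec 2020) Cor 4.10 (v) p. 160. Claim key `Mochizuki2012` DISPUTED (D-0012);
[cite: Mochizuki2012, Thm 1.5 (v) p.50].

The GAP row G-w4d009-1 (abc-iut-w4-d009) asked for `theorem cor410v_realified_kills_aut (G : LatticeGlue S) (H : S.DHT)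
(a : G.biCoric.dvDeltaOf H ≅ G.biCoric.dvDeltaOf H) : G.biCoric.realified.mapIso a = Iso.refl _` "for the REAL instantiation of
`realified`". The tree now has: the bridge for every `B` read as Cor 4.5 (ii)'s functor (p417639), the real-frame form over `StripFrame.ofKits`
(abc-iut-w4-d009 g2, p418793), the toy bi-coric kit (p420509) and the toy glue (p420737). THIS FILE states the signature AT A CONCRETE
`G := KitsToy.latticeGlue l hl` — no hypothesis, no free functor: `KitsToy.latticeGlue_cor410v_realified_kills_aut`; with
`latticeGlue_thm15vSingleIso` ([IUTchIII] Thm 1.5 (v), FACT-LIST F-2067) and `latticeGlue_realifiedRigidAt` (F-2066) for the glue's bi-coric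
datum. HONEST LABEL: toy kit stack (degenerate class in ADJUDICATION §4(iii) terms; target category the genuine `ℝ_{>0}`-torsor shape, source
the toy one-object `𝒟^⊢`-groupoid). Nothing here asserts a disputed claim or takes a side on [IUTchIII] Cor 3.12.
-/

noncomputable section

namespace Literature.IUT.LogThetaLattice

open CategoryTheory

namespace KitsToy

variable (l : ℕ) [Fact l.Prime] (hl : l ≠ 2)

/-- **IUTchIII:Thm1.5(iii)** (kurims p. 48) the glued toy datum's bi-coric datum IS `KitsToy.biCoricData` (`BiCoresOfKitsToy.lean`) — both are
`BiCoricData.ofKits` of `KitsToy.biCoricKit` over the same kit inputs. [claim: Mochizuki2012, status: disputed] -/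
theorem latticeGlue_biCoric : (latticeGlue l hl).biCoric = biCoricData l hl := rfl

/-- **IUTchIII:Thm1.5(v)** (kurims p. 50) «induce … AN isomorphism of collections of data» HOLDS for the bi-coric datum of the glued toy
kit-frame data `KitsToy.latticeGlue` — no hypothesis (F-2067 at this `B`). [claim: Mochizuki2012, status: disputed] -/
theorem latticeGlue_thm15vSingleIso : (latticeGlue l hl).biCoric.Thm15vSingleIso := thm15vSingleIso l hl

/-- **IUTchII:Cor4.10(v)** (kurims p. 160) the consumer hypothesis `RealifiedRigidAt` (F-2066) HOLDS at every pair of `𝒟^⊢`-prime-strips for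
the glued toy kit-frame data. [claim: Mochizuki2012, status: disputed] -/
theorem latticeGlue_realifiedRigidAt (A B : (frame l hl).Dv) : (latticeGlue l hl).biCoric.RealifiedRigidAt A B :=
  realifiedRigidAt l hl A B

/-- **IUTchII:Cor4.10(v)** (kurims p. 160) / **IUTchIII:Thm1.5(v)** — the literal signature of plan/GAP-LEDGER.md G-w4d009-1 AT A CONCRETE
`G : LatticeGlue S` (`G := KitsToy.latticeGlue l hl`, `S := KitsToy.frame l hl`): `D^⊩(−)` kills every automorphism of every
`^{n,m}𝔇^⊢_△` — NO hypothesis, NO free functor (via abc-iut-w4-d009's criterion `realifiedRigidAt_self_iff`).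
[claim: Mochizuki2012, status: disputed] -/
theorem latticeGlue_cor410v_realified_kills_aut (H : (frame l hl).DHT)
    (a : (latticeGlue l hl).biCoric.dvDeltaOf H ≅ (latticeGlue l hl).biCoric.dvDeltaOf H) :
    (latticeGlue l hl).biCoric.realified.mapIso a = Iso.refl _ :=
  ((biCoricData l hl).realifiedRigidAt_self_iff _).mp (realifiedRigidAt l hl _ _) a

/-- **IUTchIII:Thm1.5(v)** (kurims pp. 50–51) «bi-coric»: hence at the glued toy datum THE isomorphisms
`(D^⊩(^{p}𝔇^⊢_△), …) ⥲ (D^⊩(^{q}𝔇^⊢_△), …)` compose transitively along any three `𝒟`-Hodge theaters (abc-iut-w4-d009's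
`biCoricRealifiedIso_trans` with its hypothesis discharged). [claim: Mochizuki2012, status: disputed] -/
theorem latticeGlue_biCoricRealifiedIso_trans {H₁ H₂ H₃ : (frame l hl).DHT}
    (h₁₂ : Nonempty ((latticeGlue l hl).biCoric.dvDeltaOf H₁ ≅ (latticeGlue l hl).biCoric.dvDeltaOf H₂))
    (h₂₃ : Nonempty ((latticeGlue l hl).biCoric.dvDeltaOf H₂ ≅ (latticeGlue l hl).biCoric.dvDeltaOf H₃))
    (h₁₃ : Nonempty ((latticeGlue l hl).biCoric.dvDeltaOf H₁ ≅ (latticeGlue l hl).biCoric.dvDeltaOf H₃)) :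
    (latticeGlue l hl).biCoric.biCoricRealifiedIso h₁₂ ≪≫ (latticeGlue l hl).biCoric.biCoricRealifiedIso h₂₃ =
      (latticeGlue l hl).biCoric.biCoricRealifiedIso h₁₃ :=
  (biCoricData l hl).biCoricRealifiedIso_trans (thm15vSingleIso l hl) h₁₂ h₂₃ h₁₃

end KitsToy

end Literature.IUT.LogThetaLattice

end
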